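import Summits.Ventures.YMGap.RobustBall.RobustSlabDoorClustering
import HarnessLib

/-!
# Robust ball (Y2), area-law side, part 5c — the robust slab door with SITE-DEPENDENT loads (affine-vertex bookkeeping)

HONEST FRAMING: venture file of the cell `pub-ymgap` (QuantumFields programme), track ROBUST-BALL.  The same robust slab door as
`RobustSlabDoor` / `RobustSlabDoorClustering`, with the self-Lipschitz load `ℓ(x)` and the cross-Lipschitz row bound `Λ₀(x)` allowed to
depend on the site and the Dobrushin row sum bounded by a PARAMETER `c` with `e^δ(1 + 2√N ℓ(x))·2n|β|K + √N Λ₀(x) ≤ c ≤ 1` at every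
site — this is what turns the ball's PER-LINK constraint `ℓ_s(e) + Λ(e) ≤ ε₁` into the affine-vertex row condition
`e^{ε₀} c_W + max(2√N e^{ε₀} c_W, √N)·ε₁ < 1` (DESIGN §6) instead of the lossy `ℓ = Λ₀ = ε₁`.  Proofs are those of parts 5/5b verbatim.
Strong-coupling finite-lattice statement; nothing about the continuum, a mass gap, or Clay.
-/

noncomputable section

open MeasureTheory ProbabilityTheory
open scoped Matrix
open Literature.Probability.LatticeModels hiding glue
open Literature.Probability.LatticeModels.DobrushinMetric
open Literature.MathematicalPhysics.QuantumLattice (fundamentalRep continuous_fundamentalRep fundamentalRep_apply)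
open Literature.MathematicalPhysics.QuantumFieldTheory
open Literature.MathematicalPhysics.QuantumFieldTheory.DurhuusFrohlich
open Literature.MathematicalPhysics.QuantumFieldTheory.Balaban1983to89.StrongCouplingDobrushinWindow (OneLinkKRModulus)

namespace Summit.Ventures.YMGap.RobustBall

variable {n L N : ℕ} [NeZero L] {W : GaugeConfig (n + 1) L (SU N) → ℝ}

/-- **Dobrushin's condition for the perturbed slab specification, SITE-DEPENDENT self-Lipschitz load** (as
`isKRContraction_slabSpecW` with `ℓ = ℓ(x)`).  Inputs: a one-link modulus
`OneLinkKRModulus N R K` on the ball `R ≥ 2n|β|`; extra neighbourhoods `nbrW x ∌ x` such that the site re-weightings `h_{x,ω}` read the boundary condition only on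
`slabNbr x ∪ nbrW x` (up to `g`-independent constants); per-site loads of the re-weighting:
oscillation `h_{x,ω}(g) - h_{x,ω}(g') ≤ δ`, self-Lipschitz `|h_{x,ω}(g) - h_{x,ω}(g')| ≤ ℓ‖g - g'‖_F`, cross-Lipschitz
`|h_{x,ω}(g) - h_{x,η}(g)| ≤ Λ(x,y)‖ω_y - η_y‖_F` for `ω = η` off `y`.  Output: `IsKRContraction` with
`C(x,y) = K e^δ (1 + 2√N ℓ) |β| m(x,y) + √N Λ(x,y)` (re-weighting leg + cross leg of `su_oneLink_robust_influence`).
[cite: Follmer1988, Ch. I (2.20)] -/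
theorem isKRContraction_slabSpecW_site (hN : 1 ≤ N) (hL1 : L ≠ 1) (v : Fin (n + 1)) (t : ZMod L)
    {β R K δ : ℝ} (hK : 0 ≤ K) (ℓ : TorusSite n L → ℝ) (hℓ : ∀ x, 0 ≤ ℓ x) (hR : |β| * (2 * (n : ℝ)) ≤ R)
    (hmod : OneLinkKRModulus N R K)
    (hWm : Measurable W) (hWb : ∃ C, ∀ U, |W U| ≤ C) (r : {e : Edge (n + 1) L // ¬ IsSlab v t e} → SU N)
    (nbrW : TorusSite n L → Finset (TorusSite n L)) (hnotW : ∀ x, x ∉ nbrW x)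
    (hdep : ∀ x (η η' : TorusSite n L → SU N), (∀ z ∈ Slab.slabNbr x ∪ nbrW x, η z = η' z) →
      ∃ c : ℝ, ∀ g, siteTiltW v t W r x η g = c + siteTiltW v t W r x η' g)
    (hδ : ∀ x ω g g', siteTiltW v t W r x ω g - siteTiltW v t W r x ω g' ≤ δ)
    (hℓ' : ∀ x ω g g', |siteTiltW v t W r x ω g - siteTiltW v t W r x ω g'| ≤ ℓ x * suFrobDist g g')
    (Λ : TorusSite n L → TorusSite n L → ℝ) (hΛ0 : ∀ x y, 0 ≤ Λ x y)
    (hΛ : ∀ x y (ω η : TorusSite n L → SU N), (∀ z, z ≠ y → ω z = η z) → ∃ c : ℝ, ∀ g,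
      |siteTiltW v t W r x ω g - (c + siteTiltW v t W r x η g)| ≤ Λ x y * suFrobDist (ω y) (η y)) :
    IsKRContraction (slabSpecW v t β W r) suFrobDist (fun x => Slab.slabNbr x ∪ nbrW x)
      (fun x y => K * Real.exp δ * (1 + 2 * Real.sqrt N * ℓ x) * |β| * (Slab.slabInfluence x y : ℝ) + Real.sqrt N * Λ x y) := by
  classical
  have hL : ∀ e : Slab.SlabEdge n L, e.tgt ≠ e.1 := Slab.SlabEdge.tgt_ne_fst hL1
  have hnot : ∀ x, x ∉ Slab.slabNbr x ∪ nbrW x := fun x =>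
    Finset.notMem_union.2 ⟨Slab.not_mem_slabNbr hL x, hnotW x⟩
  refine ⟨hnot, fun x y => by have := hΛ0 x y; have := hℓ x; positivity, fun x η η' h => ?_, ?_⟩
  · -- finite range: the site law reads `ω` on `nbr x` only (Wilson part through `slabNbr x ⊆ nbr x`, `W` part up to a constant)
    obtain ⟨c, hc⟩ := hdep x η η' h
    have hF : Slab.slabField β (topOf v t r) (botOf v t r) η x = Slab.slabField β (topOf v t r) (botOf v t r) η' x := by
      unfold Slab.slabField
      rw [Slab.slabStapleSum_congr _ _ x (fun z hz => h z (Finset.mem_union_left _ hz))]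
    have hh : (fun g => -siteTiltW v t W r x η g) = fun g => -c + -siteTiltW v t W r x η' g := by
      funext g; rw [hc g]; ring
    haveI := OneLinkTiltStability.su_isProbabilityMeasure_tilted_linear (N := N)
      (Slab.slabField β (topOf v t r) (botOf v t r) η' x)
    rw [siteLaw_slabSpecW_thooft v t β hWm r x η hL, siteLaw_slabSpecW_thooft v t β hWm r x η' hL, hF, hh]
    exact tilted_const_add_eq _ _ _
  · intro x y _ ω η hωη φ Lφ hφm hφb hL0 hφL
    obtain ⟨c, hc⟩ := hΛ x y ω η hωη
    rw [siteLaw_slabSpecW_thooft v t β hWm r x ω hL, siteLaw_slabSpecW_thooft v t β hWm r x η hL]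
    have hBω : matrixOpNorm (Slab.slabField β (topOf v t r) (botOf v t r) ω x) ≤ R :=
      (Slab.matrixOpNorm_slabField_le hN β _ _ ω x).trans hR
    have hBη : matrixOpNorm (Slab.slabField β (topOf v t r) (botOf v t r) η x) ≤ R :=
      (Slab.matrixOpNorm_slabField_le hN β _ _ η x).trans hR
    -- shifting the second re-weighting by the constant `c` does not change its one-site law
    haveI := OneLinkTiltStability.su_isProbabilityMeasure_tilted_linear (N := N)
      (Slab.slabField β (topOf v t r) (botOf v t r) η x)
    have hshift : ((haarProbability (SU N)).tilted fun g : SU N =>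
          (N : ℝ) * ((g : Matrix (Fin N) (Fin N) ℂ) * Slab.slabField β (topOf v t r) (botOf v t r) η x).trace.re).tilted
          (fun g => -siteTiltW v t W r x η g) =
        ((haarProbability (SU N)).tilted fun g : SU N =>
          (N : ℝ) * ((g : Matrix (Fin N) (Fin N) ℂ) * Slab.slabField β (topOf v t r) (botOf v t r) η x).trace.re).tilted
          (fun g => -(c + siteTiltW v t W r x η g)) := by
      have : (fun g : SU N => -(c + siteTiltW v t W r x η g)) = fun g => -c + -siteTiltW v t W r x η g := by
        funext g; ring
      rw [this, tilted_const_add_eq]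
    rw [hshift]
    obtain ⟨M, hM⟩ := exists_abs_siteTiltW_le v t hWb r x η
    have key := OneLinkTiltStability.su_oneLink_robust_influence (N := N) (s := Λ x y * suFrobDist (ω y) (η y)) (hℓ x) hmod
      _ _ hBω hBη (siteTiltW v t W r x ω) (fun g => c + siteTiltW v t W r x η g) (measurable_siteTiltW v t hWm r x ω)
      ((measurable_siteTiltW v t hWm r x η).const_add c) ⟨|c| + M, fun g => (abs_add_le _ _).trans (by linarith [hM g])⟩
      (hδ x ω) (hℓ' x ω) hc φ Lφ hφm hφb hL0 hφL
    refine key.trans ?_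
    have hdiff := Slab.frobNorm_slabField_sub_le β (topOf v t r) (botOf v t r) x y hωη
    have hfac : 0 ≤ K * Real.exp δ * (1 + 2 * Real.sqrt N * ℓ x) := by have := hℓ x; positivity
    calc (K * Real.exp δ * (1 + 2 * Real.sqrt N * ℓ x) *
            frobNorm (Slab.slabField β (topOf v t r) (botOf v t r) ω x - Slab.slabField β (topOf v t r) (botOf v t r) η x) +
            Real.sqrt N * (Λ x y * suFrobDist (ω y) (η y))) * Lφ
        ≤ (K * Real.exp δ * (1 + 2 * Real.sqrt N * ℓ x) * (|β| * Slab.slabInfluence x y * suFrobDist (ω y) (η y)) +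
            Real.sqrt N * (Λ x y * suFrobDist (ω y) (η y))) * Lφ :=
          mul_le_mul_of_nonneg_right (add_le_add (mul_le_mul_of_nonneg_left hdiff hfac) le_rfl) hL0
      _ = (K * Real.exp δ * (1 + 2 * Real.sqrt N * ℓ x) * |β| * (Slab.slabInfluence x y : ℝ) + Real.sqrt N * Λ x y) * Lφ *
            suFrobDist (ω y) (η y) := by ring

/-- Row sums with site-dependent loads: `∑_{y} C(x,y) ≤ e^δ(1 + 2√N ℓ(x))·2n|β|K + √N Λ₀(x)`. [folklore] -/
theorem slabW_rowsum_le_site (x : TorusSite n L) {β K δ : ℝ} (hK : 0 ≤ K) (ℓ Λ₀ : TorusSite n L → ℝ) (hℓ : 0 ≤ ℓ x)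
    (nbrW : TorusSite n L → Finset (TorusSite n L))
    (Λ : TorusSite n L → TorusSite n L → ℝ) (hrow : ∑ y ∈ Slab.slabNbr x ∪ nbrW x, Λ x y ≤ Λ₀ x) :
    ∑ y ∈ Slab.slabNbr x ∪ nbrW x,
        (K * Real.exp δ * (1 + 2 * Real.sqrt N * ℓ x) * |β| * (Slab.slabInfluence x y : ℝ) + Real.sqrt N * Λ x y) ≤
      Real.exp δ * (1 + 2 * Real.sqrt N * ℓ x) * (2 * (n : ℝ) * |β| * K) + Real.sqrt N * Λ₀ x :=
  slabW_rowsum_le x hK hℓ nbrW Λ hrow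

/-- **Robust slab door, covariance form, site-dependent loads and a row-sum parameter `c`.**  As `slab_covariance_le_W` with  Under the hypotheses of `isKRContraction_slabSpecW` and the row-sum bound
`c := e^δ(1 + 2√N ℓ)·2n|β|K + √N Λ₀ ≤ 1`, for EVERY rest `r`, all bounded measurable single-site observables `f, g` at `x, y` with
Frobenius-Lipschitz constants `δf, δg`, and every profile `ℓ'` vanishing at `y` and 1-Lipschitz along `nbr`:
`|Cov_{slabLawW}(f, g)| ≤ 2(2√N)² δg δf c^{ℓ' x}` — no dependence on `r`, `L`, the boundary fields beyond `c`.
[cite: CaoNissimSheffield2025dynamical, Def. 2.1 and Thm. 2.3] [cite: Follmer1988, Ch. I Theorem (2.13)] -/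
theorem slab_covariance_le_W_site (hN : 1 ≤ N) (hL1 : L ≠ 1) (v : Fin (n + 1)) (t : ZMod L)
    {β R K δ c : ℝ} (hK : 0 ≤ K) (ℓ Λ₀ : TorusSite n L → ℝ) (hℓ : ∀ x, 0 ≤ ℓ x) (hR : |β| * (2 * (n : ℝ)) ≤ R)
    (hmod : OneLinkKRModulus N R K)
    (hWm : Measurable W) (hWb : ∃ C, ∀ U, |W U| ≤ C) (r : {e : Edge (n + 1) L // ¬ IsSlab v t e} → SU N)
    (nbrW : TorusSite n L → Finset (TorusSite n L)) (hnotW : ∀ x, x ∉ nbrW x)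
    (hdep : ∀ x (η η' : TorusSite n L → SU N), (∀ z ∈ Slab.slabNbr x ∪ nbrW x, η z = η' z) →
      ∃ c : ℝ, ∀ g, siteTiltW v t W r x η g = c + siteTiltW v t W r x η' g)
    (hδ : ∀ x ω g g', siteTiltW v t W r x ω g - siteTiltW v t W r x ω g' ≤ δ)
    (hℓ' : ∀ x ω g g', |siteTiltW v t W r x ω g - siteTiltW v t W r x ω g'| ≤ ℓ x * suFrobDist g g')
    (Λ : TorusSite n L → TorusSite n L → ℝ) (hΛ0 : ∀ x y, 0 ≤ Λ x y)
    (hΛ : ∀ x y (ω η : TorusSite n L → SU N), (∀ z, z ≠ y → ω z = η z) → ∃ c : ℝ, ∀ g,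
      |siteTiltW v t W r x ω g - (c + siteTiltW v t W r x η g)| ≤ Λ x y * suFrobDist (ω y) (η y))
    (hrow : ∀ x, ∑ y ∈ Slab.slabNbr x ∪ nbrW x, Λ x y ≤ Λ₀ x) (hc0 : 0 ≤ c) (hc1 : c ≤ 1)
    (hrowc : ∀ x, Real.exp δ * (1 + 2 * Real.sqrt N * ℓ x) * (2 * (n : ℝ) * |β| * K) + Real.sqrt N * Λ₀ x ≤ c)
    (x y : TorusSite n L)
    {f g : (TorusSite n L → SU N) → ℝ} (hfm : Measurable f) (hfdep : DependsOn f ({x} : Set (TorusSite n L)))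
    {Mf : ℝ} (hMf : ∀ σ, |f σ| ≤ Mf) {δf : ℝ} (hδf : IsLipBound suFrobDist f fun z => if z = x then δf else 0)
    (hgm : Measurable g) (hgdep : DependsOn g ({y} : Set (TorusSite n L))) {Mg : ℝ} (hMg : ∀ σ, |g σ| ≤ Mg)
    {δg : ℝ} (hδg : IsLipBound suFrobDist g fun z => if z = y then δg else 0)
    (prof : TorusSite n L → ℕ) (hprof0 : prof y = 0)
    (hprof : ∀ z, z ≠ y → ∀ w ∈ Slab.slabNbr z ∪ nbrW z, prof z ≤ prof w + 1) :
    |cov[f, g; slabLawW v t β W r]| ≤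
      2 * (2 * Real.sqrt N) ^ 2 * δg * (c ^ prof x * δf) := by
  classical
  have hγ := isSpecification_slabSpecW (n := n) (L := L) v t β hWm hWb r
  have hKR := isKRContraction_slabSpecW_site hN hL1 v t hK ℓ hℓ hR hmod hWm hWb r nbrW hnotW hdep hδ hℓ' Λ hΛ0 hΛ
  have key := abs_covariance_le_of_isKRContraction hγ hKR suFrobDist_nonneg suFrobDist_le (by positivity) hc0 hc1
    (fun z => (slabW_rowsum_le_site z hK ℓ Λ₀ (hℓ z) nbrW Λ (hrow z)).trans (hrowc z))
    (isGibbsMeasure_slabLawW v t β hWm hWb r) hfm (Δf := {x})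
    (by simpa using hfdep) hMf hδf hgm (Δg := {y}) (by simpa using hgdep) hMg hδg prof
    (fun z hz => by rw [Finset.mem_singleton.1 hz, hprof0]) (fun z hz w hw => hprof z (by simpa using hz) w hw)
  simpa using key

/-- **The robust slab door in clustering shape, site-dependent loads / row-sum parameter `c`** (cf. (= hypothesis `hcov` of `robust_slab_criterion`, for one rest `r`).  Under the
hypotheses of `slab_covariance_le_W` (one-link modulus on the slab ball, per-site loads `δ, ℓ, Λ` of the re-weighting with row bound
`Λ₀`, row sum `c ≤ 1`) and neighbourhoods of graph-diameter `≤ r_W` (`r_W ≥ 1`): for all sites `x, y`, indices and `φ, ψ ∈ {Re, Im}`,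
`|Cov_{slabLawW}(φ(Q_x)_{ij}, ψ(Q_y⁻¹)_{kl})| ≤ (8N/c') e^{-((-log c')/r_W) d(x,y)}`, `c' = max(c, 1/2)` — constants independent of the rest,
the boundary fields, the height and `L`. [cite: CaoNissimSheffield2025dynamical, Theorem 2.3] [cite: Follmer1988, Ch. I Theorem (2.13)] -/
theorem slabLawW_entry_cov_le_site (hN : 1 ≤ N) (v : Fin (n + 1)) (t : ZMod L)
    {β R K δ c : ℝ} (hK : 0 ≤ K) (ℓ Λ₀ : TorusSite n L → ℝ) (hℓ : ∀ x, 0 ≤ ℓ x) (hR : |β| * (2 * (n : ℝ)) ≤ R)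
    (hmod : OneLinkKRModulus N R K)
    (hWm : Measurable W) (hWb : ∃ C, ∀ U, |W U| ≤ C) (r : {e : Edge (n + 1) L // ¬ IsSlab v t e} → SU N)
    (nbrW : TorusSite n L → Finset (TorusSite n L)) (hnotW : ∀ x, x ∉ nbrW x)
    (hdep : ∀ x (η η' : TorusSite n L → SU N), (∀ z ∈ Slab.slabNbr x ∪ nbrW x, η z = η' z) →
      ∃ c : ℝ, ∀ g, siteTiltW v t W r x η g = c + siteTiltW v t W r x η' g)
    (hδ : ∀ x ω g g', siteTiltW v t W r x ω g - siteTiltW v t W r x ω g' ≤ δ)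
    (hℓ' : ∀ x ω g g', |siteTiltW v t W r x ω g - siteTiltW v t W r x ω g'| ≤ ℓ x * suFrobDist g g')
    (Λ : TorusSite n L → TorusSite n L → ℝ) (hΛ0 : ∀ x y, 0 ≤ Λ x y)
    (hΛ : ∀ x y (ω η : TorusSite n L → SU N), (∀ z, z ≠ y → ω z = η z) → ∃ c : ℝ, ∀ g,
      |siteTiltW v t W r x ω g - (c + siteTiltW v t W r x η g)| ≤ Λ x y * suFrobDist (ω y) (η y))
    (hrow : ∀ x, ∑ y ∈ Slab.slabNbr x ∪ nbrW x, Λ x y ≤ Λ₀ x) (hc0 : 0 ≤ c) (hc1 : c ≤ 1)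
    (hrowc : ∀ x, Real.exp δ * (1 + 2 * Real.sqrt N * ℓ x) * (2 * (n : ℝ) * |β| * K) + Real.sqrt N * Λ₀ x ≤ c)
    {rW : ℕ} (hrW : 1 ≤ rW) (hrange : ∀ z, ∀ w ∈ Slab.slabNbr z ∪ nbrW z, torusGraphDist z w ≤ rW)
    (x y : TorusSite n L) (i j k l : Fin N) (φ ψ : ℂ → ℝ)
    (hφ : φ = Complex.re ∨ φ = Complex.im) (hψ : ψ = Complex.re ∨ ψ = Complex.im) :
    |cov[fun Q => φ ((Q x : Matrix (Fin N) (Fin N) ℂ) i j),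
        fun Q => ψ ((((Q y)⁻¹ : Matrix.specialUnitaryGroup (Fin N) ℂ) : Matrix (Fin N) (Fin N) ℂ) k l);
        slabLawW v t β W r]| ≤
      8 * N * (max c (1 / 2))⁻¹ * Real.exp (-(-Real.log (max c (1 / 2)) / rW) * torusGraphDist x y) := by
  classical
  set c' : ℝ := max c (1 / 2) with hc'
  have hc'0 : 0 < c' := lt_max_of_lt_right (by norm_num)
  have hc'1 : c' ≤ 1 := max_le hc1 (by norm_num)
  haveI := isProbabilityMeasure_slabLawW (n := n) (L := L) (N := N) v t β hWm hWb r
  obtain ⟨hfm, hfdep, hf1, hfL⟩ := Slab.entryObs_props (n := n) (L := L) x i j hφ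
  obtain ⟨hgm, hgdep, hg1, hgL⟩ := Slab.invEntryObs_props (n := n) (L := L) y k l hψ
  have hN8 : (2 : ℝ) * (2 * Real.sqrt N) ^ 2 = 8 * N := by
    rw [mul_pow, Real.sq_sqrt (Nat.cast_nonneg N)]; ring
  have hNr : (1 : ℝ) ≤ N := by exact_mod_cast hN
  by_cases hL1 : L = 1
  · -- degenerate slice: one site, crude bound `|cov| ≤ 4 ≤ 8N/c'`
    subst hL1
    have hxy : x = y := Subsingleton.elim _ _
    subst hxy
    have h4 := Slab.abs_cov_le_of_abs_le (μ := slabLawW v t β W r) hf1 hg1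
    rw [torusGraphDist_self, Nat.cast_zero, mul_zero, Real.exp_zero, mul_one]
    have hinv : (1 : ℝ) ≤ c'⁻¹ := one_le_inv_iff₀.2 ⟨hc'0, hc'1⟩
    calc _ ≤ 2 * 1 * (2 * 1) := h4
      _ ≤ 8 * N * c'⁻¹ := by nlinarith
  · obtain ⟨hp0, hp⟩ := div_profile (n := n) (L := L) y hrW (fun z => Slab.slabNbr z ∪ nbrW z) hrange
    have key := slab_covariance_le_W_site hN hL1 v t hK ℓ Λ₀ hℓ hR hmod hWm hWb r nbrW hnotW hdep hδ hℓ' Λ hΛ0 hΛ hrow hc0 hc1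
      hrowc x y
      hfm hfdep hf1 hfL hgm hgdep hg1 hgL (fun z => torusGraphDist z y / rW) hp0 hp
    have hexp := pow_div_le_exp hc0 hc1 hrW (torusGraphDist x y)
    calc _ ≤ 2 * (2 * Real.sqrt N) ^ 2 * 1 * (c ^ (torusGraphDist x y / rW) * 1) := key
      _ = 8 * N * c ^ (torusGraphDist x y / rW) := by rw [← hN8]; ring
      _ ≤ 8 * N * (c'⁻¹ * Real.exp (-(-Real.log c' / rW) * torusGraphDist x y)) :=
          mul_le_mul_of_nonneg_left hexp (by positivity)
      _ = 8 * N * c'⁻¹ * Real.exp (-(-Real.log c' / rW) * torusGraphDist x y) := by ring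


end Summit.Ventures.YMGap.RobustBall
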